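import Summits.BirchSwinnertonDyer.BirchSwinnertonDyer.Theorems.ThetaPartnerAtTwoMazurTateCongruenceAtTwoRIntegrality
import Summits.BirchSwinnertonDyer.Rank1Residual.Supersingular.SqueezeCertificates
import Summits.BirchSwinnertonDyer.Rank1Residual.Supersingular.MazurTateLayerConsistency
import Summits.BirchSwinnertonDyer.Rank1Residual.Additive.TameBranchBudgetSqueeze
import Literature.NumberTheory.EllipticCurves.SupersingularIrreducibleProofs
import Literature.NumberTheory.EllipticCurves.SerreOpenImageOrdinaryInertiaProofs
import HarnessLib

/-!
# Route `SignedLowerHalves`, crux 3 `KobayashiLowerHalfLargeImage` (item stmt-BirchSwinnertonDyer-19001):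
# the μ-DOOR of line `horocycle_mu_floor` in the kernel — ONE Mazur–Tate coefficient reads `μ(L^ε_p) = 0`,
# and a `p`-inverted Eisenstein divisibility with `μ(L^ε_p) = 0` IS Kobayashi's Eisenstein half
# (cell `bsd-ssimc`, width seat `bsd-line-slh-p1-w2` gen 5; helper file `--supports 19001`)

HONEST FRAMING: the crux (the Eisenstein half of Kobayashi's signed main conjecture on the X7
large-image class) is OPEN and nothing here proves it; BSD is not proved by any of this. THEOREMS
ONLY (no `def`, no named fact, no `sorry`). SUPPORT for the UNREGISTERED line
`Cruxes/KobayashiLowerHalfLargeImage/Lines/horocycle_mu_floor.lean` (crux idea `horocycle-mu-floor`,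
k2 g16): its support pieces, with the sketch's binder shapes VERBATIM (its `MuZero L` is the tree's
`GreenbergVatsal2000.HasUnitContent L`, the same term `∃ n, IsUnit (coeff n L)`).

* §1 `exists_eq_C_mul_of_pInverted` = the sketch's **`MuUpgrade p`** (pure `Λ`-algebra; Gauss' lemma
  for the prime `p ∈ Λ`, tree `dvd_of_dvd_C_pow_mul_of_hasUnitContent`).
* §2 **ONE Mazur–Tate element reads `μ`** at EVERY level, no descent / stabilisation: for a Pollack pair
  `(L⁺, L⁻)` of `f` (`IsPollackPair f p L⁺ L⁻`, Pollack 2003 Prop. 6.18 congruences in `Λ ⊗ ℚ_p`),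
  every `θ_n(f)` is `p`-INTEGRAL (`norm_coeff_mazurTateElement_le_one`; the `p^m` of `IsCongrModOmega`
  is vacuous by uniqueness of Weierstrass division by `ω_n`, tree `exists_coe_eq_C_mul_of_isCongrModOmega`),
  `p ∣ L⁻` (`p ∣ L⁺`) forces `θ_n ≡ 0 (mod p)` at every EVEN (ODD) `n`, hence ONE coefficient of ONE
  `θ_n` of valuation `≤ 0` gives `μ(L⁻) = 0` / `μ(L⁺) = 0` for EVERY Pollack pair
  (`hasUnitContent_minus/plus/kobayashiL_of_coeff_mazurTateElement`). The b2b readings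
  `MazurTateReduction` / `MazurTateLambdaReading` / `MazurTateLayerConsistency` read `(μ, λ)` from a
  GIVEN integral model `Θ ∈ Λ` of `θ_n`; here the certificate is on the RATIONAL coefficients of `θ_n`,
  exactly the sketch's `HoroNonvanishing f p`.
* §3 the sketch's **`DescentStabilisation` DISCHARGED** (`descentStabilisation_holds`, body verbatim) and
  **`PeriodUnit W p` DISCHARGED** at an odd good supersingular prime modulo the period named facts
  `h5`/`h3` (`periodUnit_of_named_facts` = tree `padicValRat_periodRatio_eq_zero` + Serre Prop. 12).
* §4 **THE DOOR** `kobayashiLowerDivisibility_of_pInverted_of_hasUnitContent`: the `p`-INVERTED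
  Eisenstein divisibility (the sketch's `LambdaLowerDivisibility W p ε` verbatim — what a finite-slope /
  rational engine delivers) ∧ `μ(L^ε_p) = 0` ∧ period unit ⟹ `KobayashiLowerDivisibility W p ε`; and
  the X7 reading `X7.exists_kobayashiLowerDivisibility_of_horoNonvanishing` (`∃ ε` — the crux's
  conclusion shape at one pair — from ONE `HoroNonvanishing` certificate + the λ-parts).

So the line is CUT to its real content: (Conn) `HorocycleGenerationAll` + `ReductionAtThree`,
`MuFloorResidualGeFive`, and the external `p`-inverted λ-part (`DescentStabilisation`, `PeriodUnit`,
`MuUpgrade`, `NewformExists` are no longer hypotheses). CALIBRATION / SUPPORT ONLY: not a stub of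
the line of record `kurihara_rigidity`, never a `closes`.

References: [Pollack2003] Def. 6.15, Thm. 5.6, Prop. 6.18; [Kobayashi2003] (3.4)–(3.6) (p. 7), Conjecture
(p. 2); [GreenbergVatsal2000] p. 2 (1)–(2), §3 Remark 3.4; [Washington1997] Prop. 7.2, §13.1;
[PollackWeston2011] Thm. 4.1 (the converse direction `μ(θ_n) = μ^∓` for `n ≫ 0`, NOT needed here).
-/

set_option autoImplicit false
set_option linter.dupNamespace false

noncomputable section

open scoped Classical MatrixGroups ModularForm

open CongruenceSubgroup Polynomial WeierstrassCurve Literature.NumberTheory.EllipticCurves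
  Literature.NumberTheory.EllipticCurves.ModularForms
  Literature.NumberTheory.EllipticCurves.Rank1Residual
  Literature.NumberTheory.EllipticCurves.Rank1Residual.Typed
  Literature.NumberTheory.EllipticCurves.GreenbergVatsal2000
  Literature.NumberTheory.EllipticCurves.Kobayashi2003 ZpExtension
  Summit.BirchSwinnertonDyer.Rank1Residual.Supersingular
  Summit.BirchSwinnertonDyer.BirchSwinnertonDyer.Theorems.MazurTateCongruenceAtTwoR

namespace Summit.BirchSwinnertonDyer.BirchSwinnertonDyer.Theorems.HorocycleMuDoor

/-! ## §1. `μ = 0` upgrades a `Λ[1/p]`-divisibility to a `Λ`-divisibility (the sketch's `MuUpgrade`) -/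

section MuUpgrade

variable {p : ℕ} [hp : Fact p.Prime]

/-- **`MuUpgrade` (pure `Λ`-algebra)** — the body of `HorocycleMuFloor.MuUpgrade p` verbatim. Let
`ϖ ∈ ℚ` with `ord_p ϖ = 0`, `L, g, h ∈ Λ = ℤ_p⟦T⟧` with `μ(L) = 0` (`HasUnitContent L`: `p ∤ L`), and
`ι(p^m · g) = ϖ · ι(L · h)` in `ℚ_p⟦T⟧` (`ι = iwasawaToPowerSeries`). Then `ι g = ϖ · ι(L · h')` for some
`h' ∈ Λ`: `ϖ = 0` forces `g = 0`; otherwise `ϖ` is a unit `u` of `ℤ_p`, `p^m g = L · (u h)` in `Λ`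
(`ι` injective), so `L ∣ g` by Gauss' lemma for the prime `p` of `Λ` (`dvd_of_dvd_C_pow_mul_of_hasUnitContent`),
`g = L k`, `h' := u⁻¹ k`. [cite: Washington1997, §13.1 and §7.1] [cite: GreenbergVatsal2000, p. 2, (1)–(2)] -/
theorem exists_eq_C_mul_of_pInverted (ϖ : ℚ) (L g h : IwasawaAlgebra p) (m : ℕ)
    (hϖ : padicValRat p ϖ = 0) (hL : HasUnitContent L)
    (hι : iwasawaToPowerSeries p (PowerSeries.C ((p : ℤ_[p]) ^ m) * g) =
      PowerSeries.C (ϖ : ℚ_[p]) * iwasawaToPowerSeries p (L * h)) :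
    ∃ h' : IwasawaAlgebra p,
      iwasawaToPowerSeries p g = PowerSeries.C (ϖ : ℚ_[p]) * iwasawaToPowerSeries p (L * h') := by
  by_cases hϖ0 : ϖ = 0
  · subst hϖ0
    refine ⟨0, ?_⟩
    have h0 : PowerSeries.C ((p : ℤ_[p]) ^ m) * g = 0 := by
      apply iwasawaToPowerSeries_injective p
      rw [hι, Rat.cast_zero, map_zero, zero_mul, map_zero]
    have hg : g = 0 :=
      (mul_eq_zero.mp h0).resolve_left (Summit.BirchSwinnertonDyer.Rank1Residual.X1.MuLambda.C_pow_ne_zero m)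
    rw [hg, map_zero, Rat.cast_zero, map_zero, zero_mul]
  · obtain ⟨u, hu⟩ := exists_units_coe_eq_ratCast (p := p) hϖ0 hϖ
    have hCu : ∀ X : IwasawaAlgebra p, PowerSeries.C (ϖ : ℚ_[p]) * iwasawaToPowerSeries p X =
        iwasawaToPowerSeries p (PowerSeries.C (u : ℤ_[p]) * X) := fun X ↦ by
      rw [(span_C_units_mul_eq u X).2, hu]
    have hΛ : PowerSeries.C ((p : ℤ_[p]) ^ m) * g = L * (PowerSeries.C (u : ℤ_[p]) * h) := by
      apply iwasawaToPowerSeries_injective p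
      rw [hι, hCu]
      congr 1
      ring
    obtain ⟨k, hk⟩ : L ∣ g :=
      Summit.BirchSwinnertonDyer.Rank1Residual.Additive.dvd_of_dvd_C_pow_mul_of_hasUnitContent hL m
        ⟨PowerSeries.C (u : ℤ_[p]) * h, hΛ⟩
    refine ⟨PowerSeries.C (((u⁻¹ : ℤ_[p]ˣ) : ℤ_[p])) * k, ?_⟩
    rw [hCu, hk]
    congr 1
    have huu : PowerSeries.C (u : ℤ_[p]) * PowerSeries.C (((u⁻¹ : ℤ_[p]ˣ) : ℤ_[p])) = 1 := by
      rw [← map_mul, Units.mul_inv, map_one]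
    linear_combination (-(L * k)) * huu

end MuUpgrade

/-! ## §2. ONE Mazur–Tate element reads `μ(L^∓)` (Pollack pair, any level of the right parity) -/

section MazurTate

variable {N : ℕ} {f : CuspForm (Gamma0 N) 2} {p : ℕ} [hp : Fact p.Prime]

/-- The `k`-th coefficient of `θ ∈ ℚ[X]` pushed to `ℚ_p⟦T⟧` is the rational coefficient cast to `ℚ_p`.
[folklore] -/
theorem coeff_coe_map_ratCast (θ : ℚ[X]) (k : ℕ) :
    PowerSeries.coeff k (((θ.map (algebraMap ℚ ℚ_[p]) : ℚ_[p][X]) : PowerSeries ℚ_[p])) =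
      ((θ.coeff k : ℚ) : ℚ_[p]) := by
  rw [Polynomial.coeff_coe, Polynomial.coeff_map, eq_ratCast]

/-- The `k`-th coefficient of `ι R` for a polynomial `R ∈ ℤ_p[X] ⊆ Λ` is `R.coeff k` cast to `ℚ_p`.
[folklore] -/
theorem coeff_iwasawaToPowerSeries_coe (R : ℤ_[p][X]) (k : ℕ) :
    PowerSeries.coeff k (iwasawaToPowerSeries p (R : PowerSeries ℤ_[p])) = ((R.coeff k : ℤ_[p]) : ℚ_[p]) := by
  rw [PowerSeries.coeff_map, Polynomial.coeff_coe]
  rfl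

/-- **Integral model of a Mazur–Tate element from ONE Pollack congruence.** If `θ_n(f) ≡ ω · L (mod ω_n)`
in `Λ ⊗ ℚ_p` (`IsCongrModOmega p n (mazurTateElement f p n) ω L`, `L ∈ Λ`), then `θ_n(f) = ι R` for an
`R ∈ ℤ_p[X]` of degree `< pⁿ` with `R = ω·L + ω_n·ρ`, `ρ ∈ Λ`: the Mazur–Tate element IS `p`-integral and
the congruence holds IN `Λ`. Tree `exists_coe_eq_C_mul_of_isCongrModOmega` at `c = 1`, `G = L`, using
`deg θ_n < pⁿ` (`natDegree_mazurTateElement_lt`). [cite: Pollack2003, Def. 6.15 and Prop. 6.18] [cite: Washington1997, Prop. 7.2] -/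
theorem exists_integral_of_isCongrModOmega_mazurTate {n : ℕ} {ω : ℤ[X]} {L : IwasawaAlgebra p}
    (hθ : IsCongrModOmega p n (mazurTateElement f p n) ω L) :
    ∃ (R : ℤ_[p][X]) (ρ : IwasawaAlgebra p), R.degree < ((p ^ n : ℕ) : WithBot ℕ) ∧
      (((mazurTateElement f p n).map (algebraMap ℚ ℚ_[p]) : ℚ_[p][X]) : PowerSeries ℚ_[p]) =
        iwasawaToPowerSeries p (R : PowerSeries ℤ_[p]) ∧
      (R : PowerSeries ℤ_[p]) =
        ((ω.map (Int.castRingHom ℤ_[p]) : ℤ_[p][X]) : PowerSeries ℤ_[p]) * L +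
          (((cyclotomicOmega p n).map (Int.castRingHom ℤ_[p]) : ℤ_[p][X]) : PowerSeries ℤ_[p]) * ρ := by
  have hG : iwasawaToPowerSeries p L = PowerSeries.C (1 : ℚ_[p]) * iwasawaToPowerSeries p L := by
    rw [map_one, one_mul]
  obtain ⟨R, ρ, hdeg, hθR, hR⟩ :=
    exists_coe_eq_C_mul_of_isCongrModOmega hθ (natDegree_mazurTateElement_lt f p n) hG
  refine ⟨R, ρ, hdeg, ?_, hR⟩
  rw [← hθR, map_one, one_mul]

/-- **If `p ∣ L` then `θ_n ≡ 0 (mod p)`**: in the setting of `exists_integral_of_isCongrModOmega_mazurTate`,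
if `p ∣ L` in `Λ` then every coefficient of `θ_n(f)` has `p`-adic norm `≤ p⁻¹`. Proof: `L = p M`;
Weierstrass-divide `ω M = ω_n s + R'`; then `R − p R'` is a polynomial of degree `< pⁿ` equal to
`ω_n · (ρ + p s)`, hence `0` by uniqueness of Weierstrass division (`eq_zero_of_cyclotomicOmega_mul_eq_coe`),
so `θ_n = ι(p R')`. [cite: Pollack2003, Prop. 6.18] [cite: Washington1997, Prop. 7.2] -/
theorem norm_coeff_mazurTateElement_le_inv_of_isCongrModOmega_of_C_dvd {n : ℕ} {ω : ℤ[X]}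
    {L : IwasawaAlgebra p} (hθ : IsCongrModOmega p n (mazurTateElement f p n) ω L)
    (hL : (PowerSeries.C (p : ℤ_[p]) : IwasawaAlgebra p) ∣ L) (k : ℕ) :
    ‖(((mazurTateElement f p n).coeff k : ℚ) : ℚ_[p])‖ ≤ (p : ℝ)⁻¹ := by
  obtain ⟨R, ρ, hRdeg, hθR, hR⟩ := exists_integral_of_isCongrModOmega_mazurTate hθ
  obtain ⟨M, rfl⟩ := hL
  set ωΛ : IwasawaAlgebra p := ((ω.map (Int.castRingHom ℤ_[p]) : ℤ_[p][X]) : PowerSeries ℤ_[p]) with hωΛ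
  set ωn : IwasawaAlgebra p :=
    (((cyclotomicOmega p n).map (Int.castRingHom ℤ_[p]) : ℤ_[p][X]) : PowerSeries ℤ_[p]) with hωn
  obtain ⟨s, R', hR'deg, hdiv⟩ := exists_eq_cyclotomicOmega_mul_add_coe n (ωΛ * M)
  rw [← hωn] at hdiv
  set D : ℤ_[p][X] := R - Polynomial.C (p : ℤ_[p]) * R' with hD
  have hp0 : (p : ℤ_[p]) ≠ 0 := by exact_mod_cast hp.out.ne_zero
  have hDdeg : D.degree < ((p ^ n : ℕ) : WithBot ℕ) := by
    refine lt_of_le_of_lt (Polynomial.degree_sub_le _ _) (max_lt hRdeg ?_)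
    rw [Polynomial.degree_C_mul hp0]
    exact hR'deg
  have hDeq : ωn * (ρ + PowerSeries.C (p : ℤ_[p]) * s) = (D : PowerSeries ℤ_[p]) := by
    rw [hD, Polynomial.coe_sub, Polynomial.coe_mul, Polynomial.coe_C, hR]
    linear_combination (-(PowerSeries.C (p : ℤ_[p]))) * hdiv
  have hD0 : D = 0 := (eq_zero_of_cyclotomicOmega_mul_eq_coe hDdeg hDeq).2
  have hRR' : R = Polynomial.C (p : ℤ_[p]) * R' := sub_eq_zero.mp (by rw [← hD, hD0])
  have hcoeff : (((mazurTateElement f p n).coeff k : ℚ) : ℚ_[p]) =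
      (((p : ℤ_[p]) * R'.coeff k : ℤ_[p]) : ℚ_[p]) := by
    rw [← coeff_coe_map_ratCast, hθR, coeff_iwasawaToPowerSeries_coe, hRR', Polynomial.coeff_C_mul]
  rw [hcoeff, PadicInt.coe_mul, norm_mul, PadicInt.coe_natCast, Padic.norm_p]
  exact mul_le_of_le_one_right (inv_nonneg.mpr (Nat.cast_nonneg _)) (PadicInt.norm_le_one _)

/-- A rational number `q ≠ 0` with `ord_p q ≤ 0` has `p`-adic norm `≥ 1 > p⁻¹`. [folklore] -/
theorem not_norm_le_inv_of_padicValRat_nonpos {q : ℚ} (hq0 : q ≠ 0) (hq : padicValRat p q ≤ 0) :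
    ¬ ‖((q : ℚ) : ℚ_[p])‖ ≤ (p : ℝ)⁻¹ := by
  intro hle
  have hp1 : (1 : ℝ) < p := by exact_mod_cast hp.out.one_lt
  have hne : ((q : ℚ) : ℚ_[p]) ≠ 0 := by exact_mod_cast hq0
  have h1 : (1 : ℝ) ≤ ‖((q : ℚ) : ℚ_[p])‖ := by
    rw [Padic.norm_eq_zpow_neg_valuation hne, Padic.valuation_ratCast, ← zpow_zero (p : ℝ)]
    exact zpow_le_zpow_right₀ hp1.le (by linarith)
  have h2 : (p : ℝ)⁻¹ < 1 := inv_lt_one_of_one_lt₀ hp1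
  linarith

variable {Lplus Lminus : IwasawaAlgebra p}

/-- **Every Mazur–Tate element of `f` is `p`-INTEGRAL, granted a Pollack pair** `(L⁺, L⁻) ∈ Λ²`
(`IsPollackPair f p L⁺ L⁻`: Pollack 2003 Thm. 5.6 integrality + Prop. 6.18 congruences): for every `n`
(even or odd — one congruence applies) and `k`, `‖[T^k] θ_n(f)‖_p ≤ 1`. [cite: Pollack2003, Thm. 5.6 and Prop. 6.18] -/
theorem norm_coeff_mazurTateElement_le_one (hPP : IsPollackPair f p Lplus Lminus) (n k : ℕ) :
    ‖(((mazurTateElement f p n).coeff k : ℚ) : ℚ_[p])‖ ≤ 1 := by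
  have key : ∀ {ω : ℤ[X]} {L : IwasawaAlgebra p}, IsCongrModOmega p n (mazurTateElement f p n) ω L →
      ‖(((mazurTateElement f p n).coeff k : ℚ) : ℚ_[p])‖ ≤ 1 := fun hθ ↦ by
    obtain ⟨R, ρ, -, hθR, -⟩ := exists_integral_of_isCongrModOmega_mazurTate hθ
    rw [← coeff_coe_map_ratCast, hθR, coeff_iwasawaToPowerSeries_coe]
    exact PadicInt.norm_le_one _
  rcases Nat.even_or_odd n with hn | hn
  · exact key (hPP.2.2.2 n hn)
  · exact key (hPP.2.2.1 n hn)

/-- The same integrality in valuation form: `0 ≤ ord_p [T^k] θ_n(f)` for every `n, k`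
(`padicValRat p 0 = 0`, so no non-vanishing proviso is needed). [cite: Pollack2003, Thm. 5.6 and Prop. 6.18] -/
theorem padicValRat_coeff_mazurTateElement_nonneg (hPP : IsPollackPair f p Lplus Lminus) (n k : ℕ) :
    0 ≤ padicValRat p ((mazurTateElement f p n).coeff k) := by
  have h := norm_coeff_mazurTateElement_le_one hPP n k
  rw [Padic.norm_le_one_iff_val_nonneg, Padic.valuation_ratCast] at h
  exact h

/-- **ONE even-level Mazur–Tate coefficient of non-positive valuation gives `μ(L⁻) = 0`** for EVERY
Pollack pair of `f` (`HasUnitContent L⁻`, i.e. `p ∤ L⁻`; Kobayashi's `L_p^+`, the sign `ε = 1`):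
`p ∣ L⁻` would force `θ_n ≡ 0 (mod p)` at every even `n`. No descent / stabilisation.
[cite: Pollack2003, Prop. 6.18] [cite: GreenbergVatsal2000, p. 2, (2)] -/
theorem hasUnitContent_minus_of_coeff_mazurTateElement (hPP : IsPollackPair f p Lplus Lminus)
    {n : ℕ} (hn : Even n) {k : ℕ} (hk0 : (mazurTateElement f p n).coeff k ≠ 0)
    (hk : padicValRat p ((mazurTateElement f p n).coeff k) ≤ 0) : HasUnitContent Lminus := by
  rw [hasUnitContent_iff_not_C_dvd]
  exact fun hL ↦ not_norm_le_inv_of_padicValRat_nonpos hk0 hk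
    (norm_coeff_mazurTateElement_le_inv_of_isCongrModOmega_of_C_dvd (hPP.2.2.2 n hn) hL k)

/-- **ONE odd-level Mazur–Tate coefficient of non-positive valuation gives `μ(L⁺) = 0`** for EVERY
Pollack pair of `f` (Kobayashi's `L_p^-`, the sign `ε = −1`). [cite: Pollack2003, Prop. 6.18] [cite: GreenbergVatsal2000, p. 2, (2)] -/
theorem hasUnitContent_plus_of_coeff_mazurTateElement (hPP : IsPollackPair f p Lplus Lminus)
    {n : ℕ} (hn : Odd n) {k : ℕ} (hk0 : (mazurTateElement f p n).coeff k ≠ 0)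
    (hk : padicValRat p ((mazurTateElement f p n).coeff k) ≤ 0) : HasUnitContent Lplus := by
  rw [hasUnitContent_iff_not_C_dvd]
  exact fun hL ↦ not_norm_le_inv_of_padicValRat_nonpos hk0 hk
    (norm_coeff_mazurTateElement_le_inv_of_isCongrModOmega_of_C_dvd (hPP.2.2.1 n hn) hL k)

/-- **Kobayashi's labelling**: ONE Mazur–Tate coefficient of non-positive valuation at level `n` gives
`μ(L^ε_p) = 0` for `ε = 1` if `n` is even, `ε = −1` if `n` is odd (`kobayashiL 1 = L⁻`,
`kobayashiL (−1) = L⁺`), for every Pollack pair of `f`. [cite: Kobayashi2003, (3.4)–(3.6) (p. 7)] [cite: Pollack2003, Prop. 6.18] -/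
theorem hasUnitContent_kobayashiL_of_coeff_mazurTateElement (hPP : IsPollackPair f p Lplus Lminus)
    {n k : ℕ} (hk0 : (mazurTateElement f p n).coeff k ≠ 0)
    (hk : padicValRat p ((mazurTateElement f p n).coeff k) ≤ 0) :
    HasUnitContent (kobayashiL (if Even n then 1 else -1) Lplus Lminus) := by
  rcases Nat.even_or_odd n with hn | hn
  · rw [if_pos hn, kobayashiL, if_pos rfl]
    exact hasUnitContent_minus_of_coeff_mazurTateElement hPP hn hk0 hk
  · have h1 : ((-1 : ℤˣ) = 1) ↔ False := by decide
    rw [if_neg (Nat.not_even_iff_odd.mpr hn), kobayashiL, if_neg h1.mp]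
    exact hasUnitContent_plus_of_coeff_mazurTateElement hPP hn hk0 hk

/-- **The sketch's `HoroNonvanishing f p` gives ONE SIGN with `μ(L^ε_p) = 0` for every Pollack pair of
`f`** — the sign depends only on the parity of the certifying level. [cite: Kobayashi2003, (3.4)–(3.6) (p. 7)] [cite: Pollack2003, Prop. 6.18] -/
theorem exists_sign_hasUnitContent_kobayashiL_of_horoNonvanishing
    (hcert : ∃ n k : ℕ, (mazurTateElement f p n).coeff k ≠ 0 ∧
      padicValRat p ((mazurTateElement f p n).coeff k) ≤ 0) :
    ∃ ε : ℤˣ, ∀ Lplus Lminus : IwasawaAlgebra p, IsPollackPair f p Lplus Lminus →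
      HasUnitContent (kobayashiL ε Lplus Lminus) := by
  obtain ⟨n, k, hk0, hk⟩ := hcert
  exact ⟨if Even n then 1 else -1, fun _ _ hPP ↦ hasUnitContent_kobayashiL_of_coeff_mazurTateElement hPP hk0 hk⟩

end MazurTate

/-! ## §3. The sketch's `DescentStabilisation` and `PeriodUnit`, discharged -/

section Discharge

/-- **`HorocycleMuFloor.DescentStabilisation` holds** (its body VERBATIM, `MuZero` spelled as the tree's
`HasUnitContent`): a `HoroNonvanishing f p` certificate for the newform `f` of `W` gives ONE sign `ε`
with `μ(L^ε_p) = 0` for EVERY newform `f'` of `W` (`= f`, `IsNewformOf.unique`) and every Pollack pair.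
The hypotheses `p ≠ 2`, `a_p = 0` are carried, not used. [cite: Pollack2003, Prop. 6.18] [cite: Kobayashi2003, (3.4)–(3.6) (p. 7)] -/
theorem descentStabilisation_holds :
    ∀ (W : WeierstrassCurve ℚ) [W.IsElliptic] [W.IsGloballyMinimal] (p : ℕ) [Fact p.Prime]
      [NeZero (W.conductorNorm ℤ)] (f : CuspForm (Gamma0 (W.conductorNorm ℤ)) 2),
      p ≠ 2 → IsNewformOf W f → W.frobeniusTrace p = 0 →
      (∃ n k : ℕ, (mazurTateElement f p n).coeff k ≠ 0 ∧
        padicValRat p ((mazurTateElement f p n).coeff k) ≤ 0) →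
      ∃ ε : ℤˣ, ∀ [NeZero (W.conductorNorm ℤ)] (f' : CuspForm (Gamma0 (W.conductorNorm ℤ)) 2),
        IsNewformOf W f' → ∀ Lplus Lminus : IwasawaAlgebra p, IsPollackPair f' p Lplus Lminus →
          HasUnitContent (kobayashiL ε Lplus Lminus) := by
  intro W _ _ p _ _ f _ hf _ hcert
  obtain ⟨ε, hε⟩ := exists_sign_hasUnitContent_kobayashiL_of_horoNonvanishing hcert
  refine ⟨ε, fun f' hf' Lplus Lminus hPP ↦ ?_⟩
  have hff : f' = f := hf'.unique hf
  subst hff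
  exact hε Lplus Lminus hPP

/-- **`HorocycleMuFloor.PeriodUnit W p` at an odd good supersingular prime, modulo the period named
facts** `h5` (`p ≥ 5`) / `h3` (Mazur 1978 Cor. 4.1 at `3 ∤ N`): for `p ≠ 2` of good reduction with
`p ∣ a_p` (so `E[p]` is irreducible — Serre 1972 Prop. 12, tree
`hasIrreducibleModPGaloisRep_of_dvd_frobeniusTrace`), every newform `f` of `W` and every `ϖ ∈ ℚ` with
`ϖ · Ω_W = Ω⁺_f` has `ord_p ϖ = 0` (tree `padicValRat_periodRatio_eq_zero`); conclusion = the sketch's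
body verbatim. [cite: GreenbergVatsal2000, §3, Remark 3.4] [cite: Mazur1978, Cor. 4.1] [cite: Serre1972, §1.11 Prop. 12] -/
theorem periodUnit_of_named_facts (h5 : realPeriodRat_eq_unit_mul_plusPeriod)
    (h3 : realPeriodRat_eq_unit_mul_plusPeriod_three)
    (W : WeierstrassCurve ℚ) [W.IsElliptic] [W.IsGloballyMinimal] (p : ℕ) [Fact p.Prime]
    (hp : p ≠ 2) (hgood : W.HasGoodReductionAtPrime p) (hap : (p : ℤ) ∣ W.frobeniusTrace p) :
    ∀ [NeZero (W.conductorNorm ℤ)] (f : CuspForm (Gamma0 (W.conductorNorm ℤ)) 2),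
      IsNewformOf W f → ∀ ϖ : ℚ, (ϖ : ℝ) * W.realPeriodRat = plusPeriod f → padicValRat p ϖ = 0 :=
  fun f hf ϖ hϖ ↦ padicValRat_periodRatio_eq_zero h5 h3 W p hp hgood
    (hasIrreducibleModPGaloisRep_of_dvd_frobeniusTrace W p hp
      (W.not_dvd_minimalDiscriminantInt_of_hasGoodReductionAtPrime' p hgood) hap) f hf ϖ hϖ

end Discharge

/-! ## §4. THE DOOR: `p`-inverted Eisenstein divisibility ∧ `μ(L^ε_p) = 0` ∧ period unit ⟹ Kobayashi's Eisenstein half -/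

section Door

variable (W : WeierstrassCurve ℚ) [W.IsElliptic] [W.IsGloballyMinimal] (p : ℕ) [hp : Fact p.Prime]

/-- **THE μ-DOOR to `KobayashiLowerDivisibility W p ε`.** Fix a sign `ε`. Suppose (`hlam`, the sketch's
`LambdaLowerDivisibility W p ε` VERBATIM — what a finite-slope / rational engine delivers): for every
datum `(κ, γ, f, ϖ, (L⁺, L⁻), D)` of the conjecture's quantifier, `char X^ε = (g)` with
`ι(p^m g) = ϖ · ι(L^ε_p · h)`; (`hμ`) `μ(L^ε_p) = 0` for the newform and every Pollack pair; (`hperiod`,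
the sketch's `PeriodUnit W p`) `ord_p ϖ = 0`. Then `KobayashiLowerDivisibility W p ε` (§1). CONDITIONAL
on the three displayed binders. [cite: Kobayashi2003, Conjecture (Main Conjecture) (p. 2)] [cite: GreenbergVatsal2000, p. 2, (1)–(2)] -/
theorem kobayashiLowerDivisibility_of_pInverted_of_hasUnitContent (ε : ℤˣ)
    (hlam : ∀ (κ : ZpExtension ℚ p) (γ : Field.absoluteGaloisGroup ℚ),
        κ.IsCyclotomic → κ.IsTopGenerator γ → IsCyclotomicVariable p γ →
      ∀ [NeZero (W.conductorNorm ℤ)] (f : CuspForm (Gamma0 (W.conductorNorm ℤ)) 2),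
        IsNewformOf W f → ∀ (ϖ : ℚ), (ϖ : ℝ) * W.realPeriodRat = plusPeriod f →
      ∀ (Lplus Lminus : IwasawaAlgebra p), IsPollackPair f p Lplus Lminus →
      ∀ (D : SignedSelmerDualData W κ γ ε),
        ∃ (g h : IwasawaAlgebra p) (m : ℕ), D.charIdeal = Ideal.span {g} ∧
          iwasawaToPowerSeries p (PowerSeries.C ((p : ℤ_[p]) ^ m) * g) =
            PowerSeries.C (ϖ : ℚ_[p]) * iwasawaToPowerSeries p (kobayashiL ε Lplus Lminus * h))
    (hμ : ∀ [NeZero (W.conductorNorm ℤ)] (f : CuspForm (Gamma0 (W.conductorNorm ℤ)) 2),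
      IsNewformOf W f → ∀ Lplus Lminus : IwasawaAlgebra p, IsPollackPair f p Lplus Lminus →
        HasUnitContent (kobayashiL ε Lplus Lminus))
    (hperiod : ∀ [NeZero (W.conductorNorm ℤ)] (f : CuspForm (Gamma0 (W.conductorNorm ℤ)) 2),
      IsNewformOf W f → ∀ ϖ : ℚ, (ϖ : ℝ) * W.realPeriodRat = plusPeriod f → padicValRat p ϖ = 0) :
    KobayashiLowerDivisibility W p ε := by
  intro κ γ hκ hγ hγ' _ f hf ϖ hϖ Lplus Lminus hPP D
  obtain ⟨g, h, m, hg, hι⟩ := hlam κ γ hκ hγ hγ' f hf ϖ hϖ Lplus Lminus hPP D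
  obtain ⟨h', hh'⟩ := exists_eq_C_mul_of_pInverted ϖ (kobayashiL ε Lplus Lminus) g h m
    (hperiod f hf ϖ hϖ) (hμ f hf Lplus Lminus hPP) hι
  exact ⟨g, h', hg, hh'⟩

/-- **X7 reading — the crux's conclusion shape `∃ ε, KobayashiLowerDivisibility W p ε` at ONE pair from
ONE `HoroNonvanishing` certificate.** On class X7 (good supersingular `p`, `E` not semistable), `p` odd:
the `p`-inverted Eisenstein divisibility for BOTH signs (`hlam`, external λ-part engine), the period
named facts `h5`/`h3`, and for the newform `f₀` of level `N_W` one coefficient `[T^k]θ_n(f₀) ≠ 0` with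
`ord_p ≤ 0` ⟹ `∃ ε, KobayashiLowerDivisibility W p ε` (`ε = 1` if `n` is even, `−1` if odd; §2 + §3 +
the door; `IsNewformOf.unique`). `¬ W.HasCM`, `Surj W p`, `a_p = 0` of the crux are NOT used (only
`p ∣ a_p`, for irreducibility ⟹ period unit). PER PAIR in the certificate; CONDITIONAL on `hlam`, `h5`,
`h3`. [cite: Kobayashi2003, Conjecture (p. 2)] [cite: Pollack2003, Prop. 6.18] [cite: GreenbergVatsal2000, §3, Remark 3.4] -/
theorem X7.exists_kobayashiLowerDivisibility_of_horoNonvanishing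
    (h5 : realPeriodRat_eq_unit_mul_plusPeriod) (h3 : realPeriodRat_eq_unit_mul_plusPeriod_three)
    (hp2 : p ≠ 2) (hX : ClassX7 W p)
    (hlam : ∀ (ε : ℤˣ) (κ : ZpExtension ℚ p) (γ : Field.absoluteGaloisGroup ℚ),
        κ.IsCyclotomic → κ.IsTopGenerator γ → IsCyclotomicVariable p γ →
      ∀ [NeZero (W.conductorNorm ℤ)] (f : CuspForm (Gamma0 (W.conductorNorm ℤ)) 2),
        IsNewformOf W f → ∀ (ϖ : ℚ), (ϖ : ℝ) * W.realPeriodRat = plusPeriod f →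
      ∀ (Lplus Lminus : IwasawaAlgebra p), IsPollackPair f p Lplus Lminus →
      ∀ (D : SignedSelmerDualData W κ γ ε),
        ∃ (g h : IwasawaAlgebra p) (m : ℕ), D.charIdeal = Ideal.span {g} ∧
          iwasawaToPowerSeries p (PowerSeries.C ((p : ℤ_[p]) ^ m) * g) =
            PowerSeries.C (ϖ : ℚ_[p]) * iwasawaToPowerSeries p (kobayashiL ε Lplus Lminus * h))
    [NeZero (W.conductorNorm ℤ)] {f₀ : CuspForm (Gamma0 (W.conductorNorm ℤ)) 2} (hf₀ : IsNewformOf W f₀)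
    (hcert : ∃ n k : ℕ, (mazurTateElement f₀ p n).coeff k ≠ 0 ∧
      padicValRat p ((mazurTateElement f₀ p n).coeff k) ≤ 0) :
    ∃ ε : ℤˣ, KobayashiLowerDivisibility W p ε := by
  obtain ⟨n, k, hk0, hk⟩ := hcert
  refine ⟨if Even n then 1 else -1, kobayashiLowerDivisibility_of_pInverted_of_hasUnitContent W p _
    (hlam _) ?_ (periodUnit_of_named_facts h5 h3 W p hp2 hX.1.1 hX.1.2)⟩
  intro _ f hf Lplus Lminus hPP
  have hff : f = f₀ := hf.unique hf₀
  subst hff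
  exact hasUnitContent_kobayashiL_of_coeff_mazurTateElement hPP hk0 hk

end Door

end Summit.BirchSwinnertonDyer.BirchSwinnertonDyer.Theorems.HorocycleMuDoor

end
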